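import Mathlib
import Summits.MatrixMultiplication.MatrixMultiplication.Theorems.SnSubsetDichotomyPolynomialSlackDepletionBernstein

/-!
# The area of a depleted flat block

Crux `Summit.MatrixMultiplication.MatrixMultiplication.Theses.SnSubsetDichotomy.PolynomialSlack`
(item `stmt-MatrixMultiplication-8306`), line transport-split-hull (lead c9, all-split endgame):
the rank-one / flat case of the depletion Bernstein inequality `pair_depletion_bernstein`.
For a pair `S, T ⊆ S_n` with `(s,t) ↦ s⁻¹t` injective on `S × T` and profile
`dA(i,j) = #{(s,t) : t j = s i}/(|S||T|)`, a block `I × J` carrying flat weights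
`β ≤ p ≤ 4β` on `J`, `γ ≤ q ≤ 4γ` on `I` whose `dA`-mass is depleted by a factor `1 - ε` below
its `S_n`-average has area `|I||J| ≤ 5000·n(1 + log n)·log(4K/ε)/ε²`, `K = n!/(|S||T|)`
(`area_le_of_depleted_flat_block`).
-/

namespace Summit.MatrixMultiplication.MatrixMultiplication.Theorems.PolynomialSlack

set_option linter.dupNamespace false

open scoped BigOperators

/-- The real-arithmetic bookkeeping behind `area_le_of_depleted_flat_block`: from the Bernstein
inequality at `t = εW/N` with variance proxy `Q2 ≤ 16βγ·W`, bound `m = 16βγ`, to the area bound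
`cI·cJ ≤ 5000·N·G·log(4K/ε)/ε²` (given `cI γ · cJ β ≤ W`). -/
private lemma area_arith {N G K ε β γ W Q2 cI cJ : ℝ} (hN : 0 < N) (hG1 : 1 ≤ G)
    (hK1 : 1 ≤ K) (hε : 0 < ε) (hε1 : ε ≤ 1) (hβ : 0 < β) (hγ : 0 < γ) (hW0 : 0 < W)
    (hQ2 : Q2 ≤ 16 * β * γ * W) (hIJ : cI * γ * (cJ * β) ≤ W)
    (hB : (ε * (W / N)) ^ 2 / 4 ≤ (32 * G * Q2 / N + 4 * (16 * β * γ) * (ε * (W / N))) *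
      Real.log (4 * K * (W / N) / (ε * (W / N)))) :
    cI * cJ ≤ 5000 * N * G * Real.log (4 * K / ε) / ε ^ 2 := by
  have hN0 : N ≠ 0 := hN.ne'
  set x : ℝ := W / N with hx
  have hx0 : 0 < x := div_pos hW0 hN
  have harg : 4 * K * x / (ε * x) = 4 * K / ε := mul_div_mul_right (4 * K) ε hx0.ne'
  rw [harg] at hB
  set L : ℝ := Real.log (4 * K / ε) with hL
  have hL0 : 0 < L := by
    apply Real.log_pos
    rw [lt_div_iff₀ hε]
    linarith
  have hβγ : 0 < β * γ := mul_pos hβ hγ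
  have hG0 : 0 < G := by linarith
  -- the variance proxy: `32 G Q2/N + 64 βγ ε x ≤ 576 G βγ x`
  have hQ2x : Q2 / N ≤ 16 * β * γ * x := by
    rw [hx, ← mul_div_assoc]
    exact div_le_div_of_nonneg_right hQ2 hN.le
  have hV : 32 * G * Q2 / N + 4 * (16 * β * γ) * (ε * x) ≤ 576 * G * (β * γ) * x := by
    have e1 : 32 * G * Q2 / N = 32 * (G * (Q2 / N)) := by ring
    rw [e1]
    nlinarith [mul_nonneg hG0.le (sub_nonneg.2 hQ2x),
      mul_nonneg (mul_pos hβγ hx0).le (sub_nonneg.2 (hε1.trans hG1))]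
  have h5 : (ε * x) ^ 2 / 4 ≤ 576 * G * (β * γ) * x * L :=
    hB.trans (mul_le_mul_of_nonneg_right hV hL0.le)
  have h6 : ε ^ 2 * x ≤ 2304 * G * (β * γ) * L := by
    have h' : ε ^ 2 * x * x ≤ 2304 * G * (β * γ) * L * x := by nlinarith [h5]
    exact le_of_mul_le_mul_right h' hx0
  have h7 : ε ^ 2 * W ≤ 2304 * N * G * (β * γ) * L := by
    have hWx : W = x * N := by rw [hx]; field_simp
    rw [hWx]
    calc ε ^ 2 * (x * N) = (ε ^ 2 * x) * N := by ring
      _ ≤ 2304 * G * (β * γ) * L * N := mul_le_mul_of_nonneg_right h6 hN.le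
      _ = 2304 * N * G * (β * γ) * L := by ring
  have hNGL : 0 ≤ N * G * (β * γ) * L :=
    mul_nonneg (mul_nonneg (mul_nonneg hN.le hG0.le) hβγ.le) hL0.le
  rw [le_div_iff₀ (pow_pos hε 2)]
  have h8 : cI * cJ * ε ^ 2 * (β * γ) ≤ 5000 * N * G * L * (β * γ) := by
    calc cI * cJ * ε ^ 2 * (β * γ) = ε ^ 2 * (cI * γ * (cJ * β)) := by ring
      _ ≤ ε ^ 2 * W := mul_le_mul_of_nonneg_left hIJ (sq_nonneg ε)
      _ ≤ 2304 * N * G * (β * γ) * L := h7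
      _ ≤ 5000 * N * G * L * (β * γ) := by nlinarith [hNGL]
  exact le_of_mul_le_mul_right h8 hβγ

/-- **Area of a depleted flat block.** Let `S, T ⊆ S_n` (`n ≥ 1`) be non-empty with
`(s,t) ↦ s⁻¹t` injective on `S × T`, profile `dA(i,j) = #{(s,t) ∈ S × T : t j = s i}/(|S||T|)`,
and let `I × J` carry flat weights `β ≤ p j ≤ 4β` (`j ∈ J`), `γ ≤ q i ≤ 4γ` (`i ∈ I`). If the
block is depleted, `Σ_{I×J} dA(i,j) p_j q_i ≤ (1 - ε)(Σ_J p)(Σ_I q)/n` with `0 < ε ≤ 1`, then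
`|I||J| ≤ 5000·n(1 + log n)·log(4K/ε)/ε²`, `K = n!/(|S||T|)`.
Proof: apply `pair_depletion_bernstein` to the flat weight `w(i,j) = 1_I(i) q_i · 1_J(j) p_j`
(`0 ≤ w ≤ 16βγ`, `Σ w = W := (Σ_J p)(Σ_I q)`, `Σ w² ≤ 16βγ W`) at `t = εW/n`; with
`G = 1 + log n ≥ 1 ≥ ε` this gives `ε²W²/(4n²) ≤ 576·G·βγ·(W/n)·log(4K/ε)`, i.e.
`W ≤ 2304·n·G·βγ·log(4K/ε)/ε²`, and `|I|γ·|J|β ≤ W`. [folklore] -/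
theorem area_le_of_depleted_flat_block {n : ℕ} (hn : 1 ≤ n) (S T : Finset (Equiv.Perm (Fin n)))
    (hS0 : S.Nonempty) (hT0 : T.Nonempty)
    (hinj : Set.InjOn (fun st : Equiv.Perm (Fin n) × Equiv.Perm (Fin n) => st.1⁻¹ * st.2)
      (↑S ×ˢ ↑T : Set (Equiv.Perm (Fin n) × Equiv.Perm (Fin n))))
    (dA : Fin n → Fin n → ℝ)
    (hdA : ∀ i j, dA i j =
      (((S ×ˢ T).filter fun st => st.2 j = st.1 i).card : ℝ) / (S.card * T.card : ℕ))
    (I J : Finset (Fin n)) (p q : Fin n → ℝ) (β γ ε : ℝ) (hβ : 0 < β) (hγ : 0 < γ) (hε : 0 < ε)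
    (hε1 : ε ≤ 1) (hp : ∀ j ∈ J, β ≤ p j ∧ p j ≤ 4 * β) (hq : ∀ i ∈ I, γ ≤ q i ∧ q i ≤ 4 * γ)
    (hdep : ∑ i ∈ I, ∑ j ∈ J, dA i j * p j * q i ≤
      (1 - ε) * ((∑ j ∈ J, p j) * (∑ i ∈ I, q i)) / n) :
    ((I.card * J.card : ℕ) : ℝ) ≤
      5000 * n * (1 + Real.log n) *
        Real.log (4 * ((n.factorial : ℝ) / (S.card * T.card : ℕ)) / ε) / ε ^ 2 := by
  classical
  /- (0) constants: `n > 0`, `G = 1 + log n ≥ 1`, `K = n!/(|S||T|) ≥ 1` (packing) -/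
  have hnR : (0 : ℝ) < n := by exact_mod_cast hn
  have hG1 : (1 : ℝ) ≤ 1 + Real.log n := by
    have : 0 ≤ Real.log n := Real.log_nonneg (by exact_mod_cast hn)
    linarith
  have hc0 : (0 : ℝ) < ((S.card * T.card : ℕ) : ℝ) := by
    exact_mod_cast Nat.mul_pos hS0.card_pos hT0.card_pos
  have hK1 : (1 : ℝ) ≤ (n.factorial : ℝ) / (S.card * T.card : ℕ) := by
    rw [le_div_iff₀ hc0, one_mul]
    exact_mod_cast card_mul_card_le_factorial_of_injOn hinj
  /- (1) the empty block: the right-hand side is non-negative -/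
  have hRHS0 : (0 : ℝ) ≤ 5000 * n * (1 + Real.log n) *
      Real.log (4 * ((n.factorial : ℝ) / (S.card * T.card : ℕ)) / ε) / ε ^ 2 := by
    have hL0 : 0 ≤ Real.log (4 * ((n.factorial : ℝ) / (S.card * T.card : ℕ)) / ε) := by
      apply Real.log_nonneg
      rw [le_div_iff₀ hε]
      linarith
    exact div_nonneg (mul_nonneg (mul_nonneg (mul_nonneg (by norm_num) hnR.le)
      (by linarith)) hL0) (sq_nonneg ε)
  rcases I.eq_empty_or_nonempty with hI | hI
  · rw [hI, Finset.card_empty, zero_mul, Nat.cast_zero]; exact hRHS0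
  rcases J.eq_empty_or_nonempty with hJ | hJ
  · rw [hJ, Finset.card_empty, mul_zero, Nat.cast_zero]; exact hRHS0
  /- (2) the masses `P = Σ_J p ≥ |J|β > 0`, `Q = Σ_I q ≥ |I|γ > 0` -/
  set P : ℝ := ∑ j ∈ J, p j with hP
  set Q : ℝ := ∑ i ∈ I, q i with hQ
  have hPge : (J.card : ℝ) * β ≤ P := by
    have h := Finset.card_nsmul_le_sum J p β fun j hj => (hp j hj).1
    rwa [nsmul_eq_mul] at h
  have hQge : (I.card : ℝ) * γ ≤ Q := by
    have h := Finset.card_nsmul_le_sum I q γ fun i hi => (hq i hi).1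
    rwa [nsmul_eq_mul] at h
  have hP0 : 0 < P := lt_of_lt_of_le (mul_pos (by exact_mod_cast hJ.card_pos) hβ) hPge
  have hQ0 : 0 < Q := lt_of_lt_of_le (mul_pos (by exact_mod_cast hI.card_pos) hγ) hQge
  have hW0 : 0 < P * Q := mul_pos hP0 hQ0
  have hIJ : (I.card : ℝ) * γ * ((J.card : ℝ) * β) ≤ P * Q :=
    calc (I.card : ℝ) * γ * ((J.card : ℝ) * β) = (J.card : ℝ) * β * ((I.card : ℝ) * γ) := by ring
      _ ≤ P * Q := mul_le_mul hPge hQge (mul_nonneg (Nat.cast_nonneg _) hγ.le) hP0.le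
  /- (3) the flat weight `w i j = 1_I(i) q i · 1_J(j) p j`, `0 ≤ w ≤ 16βγ` -/
  obtain ⟨w, hw⟩ : ∃ w : Fin n → Fin n → ℝ, ∀ i j,
      w i j = (if i ∈ I then q i else 0) * (if j ∈ J then p j else 0) :=
    ⟨fun i j => (if i ∈ I then q i else 0) * (if j ∈ J then p j else 0), fun _ _ => rfl⟩
  have hq'0 : ∀ i, 0 ≤ (if i ∈ I then q i else 0) := fun i => by
    split_ifs with hi
    · exact hγ.le.trans (hq i hi).1
    · exact le_rfl
  have hq'4 : ∀ i, (if i ∈ I then q i else 0) ≤ 4 * γ := fun i => by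
    split_ifs with hi
    · exact (hq i hi).2
    · linarith
  have hp'0 : ∀ j, 0 ≤ (if j ∈ J then p j else 0) := fun j => by
    split_ifs with hj
    · exact hβ.le.trans (hp j hj).1
    · exact le_rfl
  have hp'4 : ∀ j, (if j ∈ J then p j else 0) ≤ 4 * β := fun j => by
    split_ifs with hj
    · exact (hp j hj).2
    · linarith
  have hw0 : ∀ i j, 0 ≤ w i j := fun i j => by rw [hw]; exact mul_nonneg (hq'0 i) (hp'0 j)
  have hwm : ∀ i j, w i j ≤ 16 * β * γ := fun i j => by
    rw [hw]
    calc (if i ∈ I then q i else 0) * (if j ∈ J then p j else 0) ≤ (4 * γ) * (4 * β) :=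
          mul_le_mul (hq'4 i) (hp'4 j) (hp'0 j) (by linarith)
      _ = 16 * β * γ := by ring
  /- (4) the sums: `Σ w = P Q`, `Σ w² ≤ 16βγ·PQ`, `Σ dA·w = Σ_{I×J} dA p q` -/
  have hWsum : ∑ i : Fin n, ∑ j : Fin n, w i j = P * Q := by
    calc ∑ i : Fin n, ∑ j : Fin n, w i j
        = ∑ i : Fin n, (if i ∈ I then q i else 0) * ∑ j : Fin n, (if j ∈ J then p j else 0) := by
          refine Finset.sum_congr rfl fun i _ => ?_
          rw [Finset.mul_sum]
          exact Finset.sum_congr rfl fun j _ => hw i j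
      _ = (∑ i : Fin n, (if i ∈ I then q i else 0)) *
            ∑ j : Fin n, (if j ∈ J then p j else 0) := by rw [Finset.sum_mul]
      _ = Q * P := by rw [Fintype.sum_extend_by_zero, Fintype.sum_extend_by_zero]
      _ = P * Q := mul_comm _ _
  have hW2 : ∑ i : Fin n, ∑ j : Fin n, w i j ^ 2 ≤ 16 * β * γ * (P * Q) := by
    rw [← hWsum, Finset.mul_sum]
    refine Finset.sum_le_sum fun i _ => ?_
    rw [Finset.mul_sum]
    refine Finset.sum_le_sum fun j _ => ?_
    rw [sq]
    exact mul_le_mul_of_nonneg_right (hwm i j) (hw0 i j)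
  have hdw : ∑ i : Fin n, ∑ j : Fin n, dA i j * w i j = ∑ i ∈ I, ∑ j ∈ J, dA i j * p j * q i := by
    symm
    calc ∑ i ∈ I, ∑ j ∈ J, dA i j * p j * q i = ∑ i ∈ I, ∑ j ∈ J, dA i j * w i j := by
          refine Finset.sum_congr rfl fun i hi => Finset.sum_congr rfl fun j hj => ?_
          rw [hw, if_pos hi, if_pos hj]; ring
      _ = ∑ i ∈ I, ∑ j : Fin n, dA i j * w i j := by
          refine Finset.sum_congr rfl fun i _ => ?_
          refine Finset.sum_subset (Finset.subset_univ J) fun j _ hj => ?_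
          rw [hw, if_neg hj]; ring
      _ = ∑ i : Fin n, ∑ j : Fin n, dA i j * w i j := by
          refine Finset.sum_subset (Finset.subset_univ I) fun i _ hi => ?_
          refine Finset.sum_eq_zero fun j _ => ?_
          rw [hw, if_neg hi]; ring
  /- (5) the depletion hypothesis in Bernstein form at `t = ε·PQ/n`, and the conclusion -/
  have ht : 0 < ε * (P * Q / n) := mul_pos hε (div_pos hW0 hnR)
  have hdep' : ∑ i : Fin n, ∑ j : Fin n, dA i j * w i j ≤
      (∑ i : Fin n, ∑ j : Fin n, w i j) / n - ε * (P * Q / n) := by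
    rw [hdw, hWsum]
    have e : (1 - ε) * (P * Q) / n = P * Q / n - ε * (P * Q / n) := by ring
    linarith
  have hB := pair_depletion_bernstein hn S T hS0 hT0 hinj dA hdA w (16 * β * γ)
    (ε * (P * Q / n)) hw0 hwm ht hdep'
  rw [hWsum] at hB
  have key := area_arith hnR hG1 hK1 hε hε1 hβ hγ hW0 hW2 hIJ hB
  have hcast : ((I.card * J.card : ℕ) : ℝ) = (I.card : ℝ) * (J.card : ℝ) := Nat.cast_mul _ _
  rw [hcast]
  exact key

end Summit.MatrixMultiplication.MatrixMultiplication.Theorems.PolynomialSlack
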